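import Summits.HodgeConjecture.HodgeConjecture.Theorems.AnchorTransportVariationalHodgePadicDiscSupply
import Summits.HodgeConjecture.HodgeConjecture.Theorems.AnchorTransportVariationalHodgePadicFamilyModelFinset

/-!
# Route AnchorTransport — crux `VariationalHodge` (stmt-HodgeConjecture-1076), line `padic-disc-transport`:
# the ARITHMETIC DISC of STUB S with the two `W(𝔽̄_q)`-models — UNCONDITIONAL for families whose total
# space is projective over the base (in particular quasi-projective over `ℂ`)

HONEST FRAMING: research route conditional on HC_CM; not a corollary; Q11.4-sentence-2 already refuted in dim ≥ 3.
Helper file on the crux item (nothing here closes it; no definition, no named fact, no `sorry`;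
`HC_CM` does not occur). Cell `pub-hodge-ring2`, binder seat `ring2-b03` (gen 36), BINDER-OWNERS row b03.

`Theorems.padicDiscSupply` (gen 35) proves the disc form of STUB S — a prime `q ≥ N` with
`n + 6 < q`, `κ = 𝔽̄_q`, smooth proper projective `W(κ)`-models `𝒴₀` of the anchor fibre `X_{s₀}` and
`𝒴` of a `k`-GENERIC fibre `X_s` with ISOMORPHIC SPECIAL FIBRES — given, as a hypothesis, a smooth
projective model `Y ↪ ℙᴹ_B` of the family over a smooth affine model `Spec B → Spec R` of the base
curve. `Theorems.padicFamilyModel[_of_isQuasiProjectiveOver]` (this generation) constructs that model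
for every smooth projective family whose total space is projective over the base. This file composes
the two:

* `padicDiscSupply_of_projective` — the conclusion of `padicDiscSupply` for descended crux data over a
  smooth irreducible affine curve together with a closed `S`-immersion `𝒳 ↪ S ⊗ ℙᴹ_ℂ` of the
  complexified family, with NO model hypothesis;
* `padicDiscSupply_of_isQuasiProjectiveOver` — the same for a quasi-projective complexified total
  space (`HodgeTheory.IsQuasiProjectiveOver`), the carriers of `Ring2.Hypotheses.VariationalHodgeQP`;
* `padicDiscData_of_projective / _of_isQuasiProjectiveOver` — the full DISC DATA rather than the two
  models only: the base model `Spec B → Spec R` with `τ : R → ℂ` containing any prescribed finite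
  `F ⊆ ℂ` in its image, the family model `Y ↪ ℙᴹ_B`, the prime `q`, `κ = 𝔽̄_q`, the two Witt points
  `β₀ β : B → W(κ)` with the SAME reduction and agreeing on `R`, the embedding `ι : K(q, κ) → ℂ` with
  `ι ∘ β₀ | R = τ`, `ι ∘ β₀ =` the anchor `s₀`, `ι ∘ β =` a `k`-generic `s` — the input any TRANSPORT
  statement (Berthelot–Ogus across the disc `Spec (B ⊗_R W(κ))`) has to be phrased on.

What remains of STUB S as registered is the pro-class `ξ̂` and the transport
"`ξ̂|_{Y_κ}` algebraizes ⟹ `A|_{X_s}` algebraic" (crystalline ↔ Betti comparison, not typed over the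
tree's current carriers — see the skeleton's docstring).
-/

noncomputable section

-- every declaration of this problem lives in `Summit.HodgeConjecture.HodgeConjecture.…` (summit = sub-problem)
set_option linter.dupNamespace false

open CategoryTheory CategoryTheory.Limits AlgebraicGeometry MonoidalCategory
open Literature.AlgebraicGeometry.Motives Literature.AlgebraicGeometry.HodgeTheory
open scoped Isocrystal

namespace Summit.HodgeConjecture.HodgeConjecture.Theorems

/-- **The arithmetic disc of STUB S, unconditional for `S`-projective families.** For crux data
descended to a countable field `k` along `σ : k →+* ℂ` — a smooth projective family
`(baseChangeHom σ).map f₀` of relative dimension `n` whose complexified base `S` is affine,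
irreducible, smooth and one-dimensional — and a closed `S`-immersion `ι : 𝒳 ⟶ S ⊗ ℙᴹ_ℂ` of the
complexified total space over the family (`ι ≫ pr₁ = f`), every complex point `s₀` of `S` and every
`N`: there are a prime `q ≥ N` with `n + 6 < q`, `κ = 𝔽̄_q` (with all the instances STUB S quantifies
over), smooth proper `W(κ)`-models `𝒴₀`, `𝒴` of relative dimension `n`, both projective over `W(κ)`,
an embedding `ι' : K(q, κ) →+* ℂ` with `𝒴₀,K ⊗ ℂ ≅ X_{s₀}` and `𝒴_K ⊗ ℂ ≅ X_s` for a `k`-GENERIC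
complex point `s`, and an isomorphism of the special fibres `Y₀,κ ≅ Y_κ` (Maulik–Poonen 2012, §4:
spreading out + `q`-adic residue disc of the anchor). [cite: MaulikPoonen2012, §4] -/
theorem padicDiscSupply_of_projective (N : ℕ) (k : Type) [Field k] [Countable k] (σ : k →+* ℂ)
    {n M : ℕ} {𝒳₀ S₀ : SchemeOver k} (f₀ : 𝒳₀ ⟶ S₀)
    (hf : IsSmoothProjectiveFamily ((baseChangeHom σ).map f₀) n)
    [IrreducibleSpace ((baseChangeHom σ).obj S₀).left] [IsAffine ((baseChangeHom σ).obj S₀).left]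
    (hsm : AlgebraicGeometry.Smooth ((baseChangeHom σ).obj S₀).hom)
    (hdim : topologicalKrullDim ((baseChangeHom σ).obj S₀).left = 1)
    (ι : (baseChangeHom σ).obj 𝒳₀ ⟶ (baseChangeHom σ).obj S₀ ⊗ projectiveSpace M ℂ)
    [IsClosedImmersion ι.left]
    (hι : ι ≫ CartesianMonoidalCategory.fst ((baseChangeHom σ).obj S₀) (projectiveSpace M ℂ) =
      (baseChangeHom σ).map f₀)
    (s₀ : ComplexPoints ((baseChangeHom σ).obj S₀)) :
    ∃ (q : ℕ) (_ : Fact q.Prime) (κ : Type) (_ : Field κ) (_ : CharP κ q) (_ : PerfectRing κ q)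
      (_ : IsAlgClosed κ) (_ : Algebra (ZMod q) κ) (_ : Algebra.IsAlgebraic (ZMod q) κ)
      (𝒴₀ 𝒴 : SchemeOver (WittVector q κ)) (ι' : K(q, κ) →+* ℂ)
      (s : ComplexPoints ((baseChangeHom σ).obj S₀)),
      N ≤ q ∧ n + 6 < q ∧
      WittScheme.IsSmoothProperModel n 𝒴₀ ∧ WittScheme.IsSmoothProperModel n 𝒴 ∧
      Literature.AlgebraicGeometry.Crystalline.IsProjectiveOverRing 𝒴₀ ∧
      Literature.AlgebraicGeometry.Crystalline.IsProjectiveOverRing 𝒴 ∧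
      Nonempty ((baseChangeHom ι').obj (WittScheme.genericFibre 𝒴₀) ≅
        fiberOver ((baseChangeHom σ).map f₀) s₀) ∧
      Nonempty ((baseChangeHom ι').obj (WittScheme.genericFibre 𝒴) ≅
        fiberOver ((baseChangeHom σ).map f₀) s) ∧
      Nonempty (WittScheme.specialFibre 𝒴₀ ≅ WittScheme.specialFibre 𝒴) ∧
      (∀ Z : Set (ComplexPoints ((baseChangeHom σ).obj S₀)),
        IsDefinedOver σ S₀ σ.fieldRange Z → s ∈ Z → Z = Set.univ) := by
  obtain ⟨R, B, _, _, _, _, _, _, τ, πS, hπS, Y, g, emb, hemb, hembg, π𝒳, hgP, hgn, h𝒳⟩ :=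
    padicFamilyModel ((baseChangeHom σ).map f₀) hf hsm hdim ι hι
  exact padicDiscSupply N k σ f₀ hf hsm hdim τ πS hπS g emb hemb hembg hgP hgn π𝒳 h𝒳 s₀

/-- **The arithmetic disc of STUB S, unconditional for QUASI-PROJECTIVE complexified total spaces**
(the carriers of `Ring2.Hypotheses.VariationalHodgeQP`): as `padicDiscSupply_of_projective`, with the
closed `S`-immersion replaced by `HodgeTheory.IsQuasiProjectiveOver ((baseChangeHom σ).obj 𝒳₀)` — a
proper morphism from a quasi-projective scheme is projective (Hartshorne II Cor. 4.8 (e)).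
[cite: MaulikPoonen2012, §4] [cite: Hartshorne1977, Ch. II Cor. 4.8 (e)] -/
theorem padicDiscSupply_of_isQuasiProjectiveOver (N : ℕ) (k : Type) [Field k] [Countable k]
    (σ : k →+* ℂ) {n : ℕ} {𝒳₀ S₀ : SchemeOver k} (f₀ : 𝒳₀ ⟶ S₀)
    (hf : IsSmoothProjectiveFamily ((baseChangeHom σ).map f₀) n)
    [IrreducibleSpace ((baseChangeHom σ).obj S₀).left] [IsAffine ((baseChangeHom σ).obj S₀).left]
    (hsm : AlgebraicGeometry.Smooth ((baseChangeHom σ).obj S₀).hom)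
    (hdim : topologicalKrullDim ((baseChangeHom σ).obj S₀).left = 1)
    (h𝒳 : IsQuasiProjectiveOver ((baseChangeHom σ).obj 𝒳₀))
    (s₀ : ComplexPoints ((baseChangeHom σ).obj S₀)) :
    ∃ (q : ℕ) (_ : Fact q.Prime) (κ : Type) (_ : Field κ) (_ : CharP κ q) (_ : PerfectRing κ q)
      (_ : IsAlgClosed κ) (_ : Algebra (ZMod q) κ) (_ : Algebra.IsAlgebraic (ZMod q) κ)
      (𝒴₀ 𝒴 : SchemeOver (WittVector q κ)) (ι' : K(q, κ) →+* ℂ)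
      (s : ComplexPoints ((baseChangeHom σ).obj S₀)),
      N ≤ q ∧ n + 6 < q ∧
      WittScheme.IsSmoothProperModel n 𝒴₀ ∧ WittScheme.IsSmoothProperModel n 𝒴 ∧
      Literature.AlgebraicGeometry.Crystalline.IsProjectiveOverRing 𝒴₀ ∧
      Literature.AlgebraicGeometry.Crystalline.IsProjectiveOverRing 𝒴 ∧
      Nonempty ((baseChangeHom ι').obj (WittScheme.genericFibre 𝒴₀) ≅
        fiberOver ((baseChangeHom σ).map f₀) s₀) ∧
      Nonempty ((baseChangeHom ι').obj (WittScheme.genericFibre 𝒴) ≅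
        fiberOver ((baseChangeHom σ).map f₀) s) ∧
      Nonempty (WittScheme.specialFibre 𝒴₀ ≅ WittScheme.specialFibre 𝒴) ∧
      (∀ Z : Set (ComplexPoints ((baseChangeHom σ).obj S₀)),
        IsDefinedOver σ S₀ σ.fieldRange Z → s ∈ Z → Z = Set.univ) := by
  haveI := hf.isProper
  haveI : IsSeparated ((baseChangeHom σ).obj S₀).hom := inferInstance
  obtain ⟨M, ι, hι, hιf⟩ :=
    exists_isClosedImmersion_tensor_projectiveSpace_of_isQuasiProjectiveOver ((baseChangeHom σ).map f₀) h𝒳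
  haveI := hι
  exact padicDiscSupply_of_projective N k σ f₀ hf hsm hdim ι hιf s₀

/-- **The full disc data for an `S`-projective family** (Maulik–Poonen 2012, §4). For descended crux data
over a smooth irreducible affine curve with a closed `S`-immersion `ι : 𝒳 ⟶ S ⊗ ℙᴹ_ℂ` of the
complexified family, a finite `F ⊆ ℂ`, an anchor `s₀` and a bound `N`: a ring `R` of finite type over
`ℤ` with `τ : R → ℂ` whose image contains `F`, a smooth affine model `Spec B → Spec R` (relative
dimension `1`) of the base with `πS : S → Spec B` cartesian over `Spec τ`, a smooth projective model
`emb : Y ↪ ℙᴹ_B` of the family (`g` proper, smooth of relative dimension `n`, `π𝒳` cartesian), a prime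
`q ≥ N` with `n + 6 < q`, `κ = 𝔽̄_q` (with the instances STUB S quantifies over), Witt points
`β₀ β : B →+* W(κ)` agreeing on `R` and with the SAME REDUCTION `B → κ`, an embedding
`ι' : K(q, κ) →+* ℂ` with `ι' ∘ β₀ ∘ (R → B) = τ`, such that `ι' ∘ β₀` is the anchor `s₀`, `ι' ∘ β` is a
point `s`, and `s` is `k`-GENERIC (`padicFamilyModel_finset` +
`HodgeTheory.exists_wittVector_points_same_reduction_generic`). [cite: MaulikPoonen2012, §4] -/
theorem padicDiscData_of_projective (N : ℕ) (k : Type) [Field k] [Countable k] (σ : k →+* ℂ)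
    {n M : ℕ} {𝒳₀ S₀ : SchemeOver k} (f₀ : 𝒳₀ ⟶ S₀)
    (hf : IsSmoothProjectiveFamily ((baseChangeHom σ).map f₀) n)
    [IrreducibleSpace ((baseChangeHom σ).obj S₀).left] [IsAffine ((baseChangeHom σ).obj S₀).left]
    (hsm : AlgebraicGeometry.Smooth ((baseChangeHom σ).obj S₀).hom)
    (hdim : topologicalKrullDim ((baseChangeHom σ).obj S₀).left = 1)
    (ι : (baseChangeHom σ).obj 𝒳₀ ⟶ (baseChangeHom σ).obj S₀ ⊗ projectiveSpace M ℂ)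
    [IsClosedImmersion ι.left]
    (hι : ι ≫ CartesianMonoidalCategory.fst ((baseChangeHom σ).obj S₀) (projectiveSpace M ℂ) =
      (baseChangeHom σ).map f₀)
    (F : Finset ℂ) (s₀ : ComplexPoints ((baseChangeHom σ).obj S₀)) :
    ∃ (R B : Type) (_ : CommRing R) (_ : CommRing B) (_ : Algebra R B) (_ : Algebra.FiniteType ℤ R)
      (_ : Algebra.FiniteType R B)
      (_ : SmoothOfRelativeDimension 1 (Spec.map (CommRingCat.ofHom (algebraMap R B))))
      (τ : R →+* ℂ) (πS : ((baseChangeHom σ).obj S₀).left ⟶ Spec (.of B))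
      (_ : IsPullback πS ((baseChangeHom σ).obj S₀).hom
        (Spec.map (CommRingCat.ofHom (algebraMap R B))) (Spec.map (CommRingCat.ofHom τ)))
      (Y : Scheme.{0}) (g : Y ⟶ Spec (.of B))
      (emb : letI := MvPolynomial.gradedAlgebra (σ := Fin (M + 1)) (R := B)
        Y ⟶ Proj (MvPolynomial.homogeneousSubmodule (Fin (M + 1)) B))
      (_ : IsClosedImmersion emb)
      (_ : letI := MvPolynomial.gradedAlgebra (σ := Fin (M + 1)) (R := B)
        emb ≫ ProjBaseChangeRing.projToSpec (Fin (M + 1)) B = g)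
      (π𝒳 : ((baseChangeHom σ).obj 𝒳₀).left ⟶ Y)
      (q : ℕ) (_ : Fact q.Prime) (κ : Type) (_ : Field κ) (_ : CharP κ q) (_ : PerfectRing κ q)
      (_ : IsAlgClosed κ) (_ : Algebra (ZMod q) κ) (_ : Algebra.IsAlgebraic (ZMod q) κ)
      (β₀ β : B →+* WittVector q κ) (ι' : K(q, κ) →+* ℂ)
      (s : ComplexPoints ((baseChangeHom σ).obj S₀)),
      (∀ x ∈ F, x ∈ Set.range τ) ∧ IsProper g ∧ SmoothOfRelativeDimension n g ∧
      IsPullback π𝒳 ((baseChangeHom σ).map f₀).left g πS ∧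
      N ≤ q ∧ n + 6 < q ∧
      β₀.comp (algebraMap R B) = β.comp (algebraMap R B) ∧
      (WittVector.constantCoeff : WittVector q κ →+* κ).comp β₀ =
        (WittVector.constantCoeff : WittVector q κ →+* κ).comp β ∧
      ((ι'.comp (algebraMap (WittVector q κ) K(q, κ))).comp β₀).comp (algebraMap R B) = τ ∧
      s₀.left ≫ πS =
        Spec.map (CommRingCat.ofHom ((ι'.comp (algebraMap (WittVector q κ) K(q, κ))).comp β₀)) ∧
      s.left ≫ πS =
        Spec.map (CommRingCat.ofHom ((ι'.comp (algebraMap (WittVector q κ) K(q, κ))).comp β)) ∧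
      (∀ Z : Set (ComplexPoints ((baseChangeHom σ).obj S₀)),
        IsDefinedOver σ S₀ σ.fieldRange Z → s ∈ Z → Z = Set.univ) := by
  classical
  haveI : LocallyOfFiniteType ((baseChangeHom σ).obj S₀).hom := by
    haveI : Smooth ((baseChangeHom σ).obj S₀).hom := hsm
    infer_instance
  obtain ⟨R, B, _, _, _, _, _, hBd, τ, πS, hπS, Y, g, emb, hemb, hembg, π𝒳, hF, hgP, hgn, h𝒳⟩ :=
    padicFamilyModel_finset ((baseChangeHom σ).map f₀) hf hsm hdim ι hι F
  haveI := hBd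
  obtain ⟨q, hq, κ, _, _, _, _, _, _, β₀, β, ι', s, hNq, hR, hred, hτ, hs₀, hs, hgen⟩ :=
    exists_wittVector_points_same_reduction_generic σ S₀ τ πS hπS (le_of_eq hdim) s₀ (max N (n + 7))
  exact ⟨R, B, inferInstance, inferInstance, inferInstance, inferInstance, inferInstance, hBd, τ, πS, hπS,
    Y, g, emb, hemb, hembg, π𝒳, q, hq, κ, inferInstance, inferInstance, inferInstance, inferInstance,
    inferInstance, inferInstance, β₀, β, ι', s, hF, hgP, hgn, h𝒳, (le_max_left _ _).trans hNq,
    by have := (le_max_right N (n + 7)).trans hNq; omega, hR, hred, hτ, hs₀, hs, hgen⟩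

/-- **The full disc data for a QUASI-PROJECTIVE complexified total space** (the carriers of
`Ring2.Hypotheses.VariationalHodgeQP`): as `padicDiscData_of_projective`, the closed `S`-immersion being
supplied by `HodgeTheory.exists_isClosedImmersion_tensor_projectiveSpace_of_isQuasiProjectiveOver`
(Hartshorne II Cor. 4.8 (e)). [cite: MaulikPoonen2012, §4] [cite: Hartshorne1977, Ch. II Cor. 4.8 (e)] -/
theorem padicDiscData_of_isQuasiProjectiveOver (N : ℕ) (k : Type) [Field k] [Countable k]
    (σ : k →+* ℂ) {n : ℕ} {𝒳₀ S₀ : SchemeOver k} (f₀ : 𝒳₀ ⟶ S₀)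
    (hf : IsSmoothProjectiveFamily ((baseChangeHom σ).map f₀) n)
    [IrreducibleSpace ((baseChangeHom σ).obj S₀).left] [IsAffine ((baseChangeHom σ).obj S₀).left]
    (hsm : AlgebraicGeometry.Smooth ((baseChangeHom σ).obj S₀).hom)
    (hdim : topologicalKrullDim ((baseChangeHom σ).obj S₀).left = 1)
    (h𝒳 : IsQuasiProjectiveOver ((baseChangeHom σ).obj 𝒳₀))
    (F : Finset ℂ) (s₀ : ComplexPoints ((baseChangeHom σ).obj S₀)) :
    ∃ (M : ℕ) (R B : Type) (_ : CommRing R) (_ : CommRing B) (_ : Algebra R B)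
      (_ : Algebra.FiniteType ℤ R) (_ : Algebra.FiniteType R B)
      (_ : SmoothOfRelativeDimension 1 (Spec.map (CommRingCat.ofHom (algebraMap R B))))
      (τ : R →+* ℂ) (πS : ((baseChangeHom σ).obj S₀).left ⟶ Spec (.of B))
      (_ : IsPullback πS ((baseChangeHom σ).obj S₀).hom
        (Spec.map (CommRingCat.ofHom (algebraMap R B))) (Spec.map (CommRingCat.ofHom τ)))
      (Y : Scheme.{0}) (g : Y ⟶ Spec (.of B))
      (emb : letI := MvPolynomial.gradedAlgebra (σ := Fin (M + 1)) (R := B)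
        Y ⟶ Proj (MvPolynomial.homogeneousSubmodule (Fin (M + 1)) B))
      (_ : IsClosedImmersion emb)
      (_ : letI := MvPolynomial.gradedAlgebra (σ := Fin (M + 1)) (R := B)
        emb ≫ ProjBaseChangeRing.projToSpec (Fin (M + 1)) B = g)
      (π𝒳 : ((baseChangeHom σ).obj 𝒳₀).left ⟶ Y)
      (q : ℕ) (_ : Fact q.Prime) (κ : Type) (_ : Field κ) (_ : CharP κ q) (_ : PerfectRing κ q)
      (_ : IsAlgClosed κ) (_ : Algebra (ZMod q) κ) (_ : Algebra.IsAlgebraic (ZMod q) κ)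
      (β₀ β : B →+* WittVector q κ) (ι' : K(q, κ) →+* ℂ)
      (s : ComplexPoints ((baseChangeHom σ).obj S₀)),
      (∀ x ∈ F, x ∈ Set.range τ) ∧ IsProper g ∧ SmoothOfRelativeDimension n g ∧
      IsPullback π𝒳 ((baseChangeHom σ).map f₀).left g πS ∧
      N ≤ q ∧ n + 6 < q ∧
      β₀.comp (algebraMap R B) = β.comp (algebraMap R B) ∧
      (WittVector.constantCoeff : WittVector q κ →+* κ).comp β₀ =
        (WittVector.constantCoeff : WittVector q κ →+* κ).comp β ∧
      ((ι'.comp (algebraMap (WittVector q κ) K(q, κ))).comp β₀).comp (algebraMap R B) = τ ∧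
      s₀.left ≫ πS =
        Spec.map (CommRingCat.ofHom ((ι'.comp (algebraMap (WittVector q κ) K(q, κ))).comp β₀)) ∧
      s.left ≫ πS =
        Spec.map (CommRingCat.ofHom ((ι'.comp (algebraMap (WittVector q κ) K(q, κ))).comp β)) ∧
      (∀ Z : Set (ComplexPoints ((baseChangeHom σ).obj S₀)),
        IsDefinedOver σ S₀ σ.fieldRange Z → s ∈ Z → Z = Set.univ) := by
  haveI := hf.isProper
  haveI : IsSeparated ((baseChangeHom σ).obj S₀).hom := inferInstance
  obtain ⟨M, ι, hι, hιf⟩ :=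
    exists_isClosedImmersion_tensor_projectiveSpace_of_isQuasiProjectiveOver ((baseChangeHom σ).map f₀) h𝒳
  haveI := hι
  exact ⟨M, padicDiscData_of_projective N k σ f₀ hf hsm hdim ι hιf F s₀⟩

end Summit.HodgeConjecture.HodgeConjecture.Theorems

end
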